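import Mathlib
import HarnessLib
import Literature.Barriers.CriticalPhenomena.RandomClusterFirstOrder
import Literature.Probability.LatticeModels.CriticalFKIsingConnectionLaws

/-!
# Lattice translation invariance of the critical FK-Ising connection laws on `ℤ³`:
# the stub `stub_latticeTranslation` of the crux `ArmDressing.BallConnectivityMoebius`
(route ArmDressing, support item stmt-CriticalPhenomena-16131, line `registered`)

The registered stub 2a of the skeleton `Cruxes/BallConnectivityMoebius/Lines/birth.lean`: for the
wired critical FK-Ising boxes `Λ_L ↑ ℤ³` (`q = 2`, `p = 1 - e^{-2β_c(3)}`), every finite family `K` of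
lattice probe sets each finite or co-finite, every set `R` of relations and every `z ∈ ℤ³`,

  `Pr m (fun i => {x | x - z ∈ K i}) R = Pr m K R`,

where `Pr m K R = limUnder atTop (L ↦ φ¹_{Λ_L}(connection relation of K ∈ R))`. Proof: by
`Literature.Probability.LatticeModels.tendsto_rcMeasure_real_connRelLaw_criticalBeta`
(`CriticalFKIsingConnectionLaws.lean`) the box probabilities of `K` along the translated boxes `Λ_L + v`
converge to one limit `ℓ` for all `v`; the centred sequence is the case `v = 0`
(`lt_boxLaw_eq`), and by the invariance of `rcMeasure` under the translation `τ_{-z}`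
(`rcMeasure_real_preimage_relabel`, Grimmett 2006, §4.3) the centred sequence of the translated
family `K + z` is the sequence of `K` along `Λ_L - z` (`lt_boxLaw_shift_eq`); both `limUnder`s are
therefore `ℓ` (`Filter.Tendsto.limUnder_eq`). This is Grimmett 2006, Thm. (4.19)(b) (automorphism
invariance of the limit measure) for the wired measure at `p_c(2)` on `ℤ³` and connection events.

References: G. Grimmett, *The Random-Cluster Model* (2006), §4.3 and Thm. (4.19)(b).
No definitions, no named facts.
-/

namespace Summit.CriticalPhenomena.Ising3DConformalLimit.ArmDressingBallConnectivityMoebius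

open MeasureTheory Finset SimpleGraph Filter Topology
open Literature.Probability.LatticeModels Literature.Probability.Percolation
open Literature.Barriers.CriticalPhenomena

section Stub

variable {d : ℕ}

/-! ### Transport of the connection relation along lattice automorphisms -/

/-- **The connection relation is transported by a lattice automorphism**: for `g ∈ Aut(ℤ^d)` with
`S' = g(S)` and the induced isomorphism `ψ : S ≃ S'`, the relation "`K i ↔ K j` by an open path of
`S'`" of the relabelled configuration `ψ ω` is the relation "`g⁻¹ K i ↔ g⁻¹ K j` by an open path
of `S`" of `ω`. [cite: Grimmett2006, §4.3] -/
theorem lt_rel_relabel_finsetGraphIso (g : zdGraph d ≃g zdGraph d) {S S' : Finset (Site d)}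
    (hS : ∀ x, x ∈ S' ↔ g.symm x ∈ S) {m : ℕ} (K : Fin m → Set (Site d)) (ω : BondConfig ↥S) :
    (fun i j => ∃ x y : ↥S', x.1 ∈ K i ∧ y.1 ∈ K j ∧
        (openGraph (BondConfig.relabel (sym2Equiv (finsetGraphIso g hS).toEquiv) ω)).Reachable x y) =
      fun i j => ∃ x y : ↥S, g x.1 ∈ K i ∧ g y.1 ∈ K j ∧ (openGraph ω).Reachable x y := by
  funext i j
  apply propext
  constructor
  · rintro ⟨x, y, hx, hy, hxy⟩
    refine ⟨(finsetGraphIso g hS).symm x, (finsetGraphIso g hS).symm y, ?_, ?_, ?_⟩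
    · show g (g.symm x.1) ∈ K i
      rw [RelIso.apply_symm_apply]
      exact hx
    · show g (g.symm y.1) ∈ K j
      rw [RelIso.apply_symm_apply]
      exact hy
    · rw [← reachable_relabel_graphIso_iff (finsetGraphIso g hS) ω, RelIso.apply_symm_apply,
        RelIso.apply_symm_apply]
      exact hxy
  · rintro ⟨x, y, hx, hy, hxy⟩
    exact ⟨finsetGraphIso g hS x, finsetGraphIso g hS y, hx, hy,
      (reachable_relabel_graphIso_iff (finsetGraphIso g hS) ω x y).2 hxy⟩

/-- The law of the connection relation depends on the piece `S` only through its value (transport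
along an equality of finsets, used to pass between `Λ_L` and `Λ_L + 0`). [folklore] -/
theorem lt_relLaw_congr_dom {S S' : Finset (Site d)} (h : S = S') (p q : ℝ) {m : ℕ}
    (K : Fin m → Set (Site d)) (R : Set (Fin m → Fin m → Prop)) :
    (rcMeasure (finsetGraph (zdGraph d) S) p q (wiredBoundary (zdGraph d) S)).real
        {ω | (fun i j => ∃ x y : ↥S, x.1 ∈ K i ∧ y.1 ∈ K j ∧ (openGraph ω).Reachable x y) ∈ R} =
      (rcMeasure (finsetGraph (zdGraph d) S') p q (wiredBoundary (zdGraph d) S')).real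
        {ω | (fun i j => ∃ x y : ↥S', x.1 ∈ K i ∧ y.1 ∈ K j ∧ (openGraph ω).Reachable x y) ∈ R} := by
  subst h
  rfl

/-- **The centred box law is the law of `Λ_L + 0`** (the barrier file's `boxGraph`/`boxBoundary`
are definitionally the general `finsetGraph`/`wiredBoundary` of `box d L = Λ_L + 0`). [folklore] -/
theorem lt_boxLaw_eq (p q : ℝ) (L : ℕ) {m : ℕ} (K : Fin m → Set (Site d))
    (R : Set (Fin m → Fin m → Prop)) :
    (rcMeasure (boxGraph d L) p q (boxBoundary d L)).real {ω | (fun i j => ∃ x y : BoxV d L,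
        x.1 ∈ K i ∧ y.1 ∈ K j ∧ (openGraph ω).Reachable x y) ∈ R} =
      (rcMeasure (finsetGraph (zdGraph d)
          (Finset.Icc (fun i => -((L : ℕ) : ℤ) + (0 : Site d) i) (fun i => ((L : ℕ) : ℤ) + (0 : Site d) i)))
          p q (wiredBoundary (zdGraph d)
          (Finset.Icc (fun i => -((L : ℕ) : ℤ) + (0 : Site d) i) (fun i => ((L : ℕ) : ℤ) + (0 : Site d) i)))).real
        {ω | (fun i j => ∃ x y :
          ↥(Finset.Icc (fun i => -((L : ℕ) : ℤ) + (0 : Site d) i) (fun i => ((L : ℕ) : ℤ) + (0 : Site d) i)),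
          x.1 ∈ K i ∧ y.1 ∈ K j ∧ (openGraph ω).Reachable x y) ∈ R} :=
  lt_relLaw_congr_dom (box_eq_icc_shift_zero L) p q K R

/-- **The centred box law of the translated probes `K + z` is the law of `K` in `Λ_L - z`**
(invariance of the random-cluster measure under the translation `τ_{-z}`, Grimmett 2006, §4.3:
`rcMeasure_real_preimage_relabel` with `finsetGraphIso (zdShiftIso (-z))`, which maps `∂Λ_L` onto
`∂(Λ_L - z)` and the relation of `K` onto the relation of `K + z`). [cite: Grimmett2006, §4.3] -/
theorem lt_boxLaw_shift_eq {p q : ℝ} (hp : p ∈ Set.Icc (0 : ℝ) 1) (hq : 0 < q) (L : ℕ) {m : ℕ}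
    (K : Fin m → Set (Site d)) (R : Set (Fin m → Fin m → Prop)) (z : Site d) :
    (rcMeasure (boxGraph d L) p q (boxBoundary d L)).real {ω | (fun i j => ∃ x y : BoxV d L,
        x.1 ∈ {x : Site d | x - z ∈ K i} ∧ y.1 ∈ {x : Site d | x - z ∈ K j} ∧
        (openGraph ω).Reachable x y) ∈ R} =
      (rcMeasure (finsetGraph (zdGraph d)
          (Finset.Icc (fun i => -((L : ℕ) : ℤ) + (-z) i) (fun i => ((L : ℕ) : ℤ) + (-z) i)))
          p q (wiredBoundary (zdGraph d)
          (Finset.Icc (fun i => -((L : ℕ) : ℤ) + (-z) i) (fun i => ((L : ℕ) : ℤ) + (-z) i)))).real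
        {ω | (fun i j => ∃ x y :
          ↥(Finset.Icc (fun i => -((L : ℕ) : ℤ) + (-z) i) (fun i => ((L : ℕ) : ℤ) + (-z) i)),
          x.1 ∈ K i ∧ y.1 ∈ K j ∧ (openGraph ω).Reachable x y) ∈ R} := by
  have key := rcMeasure_real_preimage_relabel
    (finsetGraphIso (zdShiftIso (-z)) (mem_icc_shift_iff L (-z))) hp hq
    (wiredBoundary (zdGraph d) (box d L))
    {ω | (fun i j => ∃ x y :
      ↥(Finset.Icc (fun i => -((L : ℕ) : ℤ) + (-z) i) (fun i => ((L : ℕ) : ℤ) + (-z) i)),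
      x.1 ∈ K i ∧ y.1 ∈ K j ∧ (openGraph ω).Reachable x y) ∈ R}
  rw [image_finsetGraphIso_wiredBoundary] at key
  rw [← key]
  show (rcMeasure (finsetGraph (zdGraph d) (box d L)) p q (wiredBoundary (zdGraph d) (box d L))).real _ =
    (rcMeasure (finsetGraph (zdGraph d) (box d L)) p q (wiredBoundary (zdGraph d) (box d L))).real _
  congr 1
  ext ω
  rw [Set.mem_setOf_eq, Set.mem_preimage, Set.mem_setOf_eq, lt_rel_relabel_finsetGraphIso]
  simp only [zdShiftIso_apply, Set.mem_setOf_eq, ← sub_eq_add_neg]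

/-! ### The stub -/

-- the registered stub signature is the crux's full `let` preamble, whose `disc`/`gball`/`ginv` are
-- not used by this clause (linter.unusedVariables would flag the verbatim statement)
set_option linter.unusedVariables false in
/-- stub 2a of `Cruxes/BallConnectivityMoebius/Lines/birth.lean` (line `registered`), PROVED:
**lattice translation invariance of the thermodynamic-limit critical FK-Ising connection laws on
`ℤ³`** — for every finite family of lattice probe sets each finite or co-finite, every set `R` of
relations and every lattice vector `z`, the `limUnder` over the wired critical boxes `Λ_L ↑ ℤ³` of
the probability that the open-path connection relation among the probes lies in `R` is unchanged
when every probe is translated by `z`. Both box sequences converge to the common limit of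
`tendsto_rcMeasure_real_connRelLaw_criticalBeta` (`CriticalFKIsingConnectionLaws.lean`: ghost-wired
events antitone in the box, arm correction `→ m*(β_c(3)) = 0`, atoms by finite additivity;
translated boxes sandwiched between centred ones), the translated family's sequence being the
sequence of `K` along `Λ_L - z` by automorphism invariance. Grimmett 2006, Thm. (4.19)(b)
pattern for the wired measure at `p_c(2)` on `ℤ³`. [cite: Grimmett2006, Thm. (4.19)(b)] -/
theorem stub_latticeTranslation : open Literature.Probability.LatticeModels Literature.Probability.Percolation Literature.Barriers.CriticalPhenomena Filter Topology in let E3 := EuclideanSpace ℝ (Fin 3); let μ : (L : ℕ) → MeasureTheory.Measure (BondConfig (BoxV 3 L)) := fun L => rcMeasure (boxGraph 3 L) (fkIsingParam (criticalBeta 3)) 2 (boxBoundary 3 L); let PrL : (m : ℕ) → (Fin m → Set (Site 3)) → Set (Fin m → Fin m → Prop) → ℕ → ℝ := fun _ K R L => (μ L).real {ω | (fun i j => ∃ x y : BoxV 3 L, x.1 ∈ K i ∧ y.1 ∈ K j ∧ (openGraph ω).Reachable x y) ∈ R}; let Pr : (m : ℕ) → (Fin m → Set (Site 3)) → Set (Fin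 m → Fin m → Prop) → ℝ := fun m K R => limUnder atTop (PrL m K R); let mesh : ℝ → Site 3 → E3 := fun δ z => WithLp.toLp 2 fun i : Fin 3 => δ * (z i : ℝ); let disc : ℝ → Set E3 → Set (Site 3) := fun δ A => {x | mesh δ x ∈ A}; let gball : E3 × ℝ → Set E3 := fun p => if 0 < p.2 then Metric.closedBall p.1 p.2 else (Metric.ball p.1 (-p.2))ᶜ; let ginv : E3 × ℝ → E3 × ℝ := fun p => ((‖p.1‖ ^ 2 - p.2 ^ 2)⁻¹ • p.1, p.2 / (‖p.1‖ ^ 2 - p.2 ^ 2)); (∀ (m : ℕ) (R : Set (Fin m → Fin m → Prop)) (K : Fin m → Set (Site 3)) (z : Site 3), (∀ i, (K i).Finite ∨ (K i)ᶜ.Finite) → Pr m (fun i => {x | x - z ∈ K i}) R = Pr m K R) := by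
  dsimp only
  intro m R K z hK
  have hp : fkIsingParam (criticalBeta 3) ∈ Set.Icc (0 : ℝ) 1 :=
    fkIsingParam_mem_Icc (criticalBeta_nonneg 3)
  obtain ⟨ℓ, hℓ⟩ := tendsto_rcMeasure_real_connRelLaw_criticalBeta (d := 3) le_rfl hK R
  have h1 : Tendsto (fun L : ℕ => (rcMeasure (boxGraph 3 L) (fkIsingParam (criticalBeta 3)) 2
      (boxBoundary 3 L)).real {ω | (fun i j => ∃ x y : BoxV 3 L, x.1 ∈ K i ∧ y.1 ∈ K j ∧
        (openGraph ω).Reachable x y) ∈ R}) atTop (𝓝 ℓ) :=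
    (hℓ 0).congr fun L => (lt_boxLaw_eq _ _ L K R).symm
  have h2 : Tendsto (fun L : ℕ => (rcMeasure (boxGraph 3 L) (fkIsingParam (criticalBeta 3)) 2
      (boxBoundary 3 L)).real {ω | (fun i j => ∃ x y : BoxV 3 L, x.1 ∈ {x : Site 3 | x - z ∈ K i} ∧
        y.1 ∈ {x : Site 3 | x - z ∈ K j} ∧ (openGraph ω).Reachable x y) ∈ R}) atTop (𝓝 ℓ) :=
    (hℓ (-z)).congr fun L => (lt_boxLaw_shift_eq hp two_pos L K R z).symm
  exact h2.limUnder_eq.trans h1.limUnder_eq.symm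

end Stub

end Summit.CriticalPhenomena.Ising3DConformalLimit.ArmDressingBallConnectivityMoebius
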